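import Mathlib
import Literature.Analysis.FluidPDE.AxisymmetricEuler
import Literature.Analysis.FluidPDE.RusinSverakLerayAeEqKatoHolds
import Literature.Analysis.FluidPDE.RusinSverakKatoBoundHolds
import HarnessLib.Audit
import HarnessLib

/-!
# L3TimeExponentPincer — the node (SFL³): swirl-free local Leray solutions with `L³` data are regular

Support file for the crux `L3CascadeJaw` (item stmt-NavierStokesRegularity-19499) of route
`L3TimeExponentPincer`, swirl-free calibration cell of planner nsreg-p2's ROUND-12 («THE CRITICAL
MODULUS», memo `HOME/ns-regularity-ideate-p2/ROUND-12.md` §2b and Addendum A, evidence on the item).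
There the velocity-indexed critical smoothing modulus in the swirl-free class
(`…Theorems.L3TimeExponentPincerCritModulus.CritSmoothingNoSwirlB`, an `@[conjecture]` node) is
REDUCED by Jia–Šverák compactness to the regularity of swirl-free axisymmetric local Leray
(Jia–Šverák class `𝒩(u₀)`) solutions with `L³` initial velocity.  This file TYPES the target of
that reduction as obligation nodes, in the tree's vocabulary (`IsLocalLeraySolution`,
`IsKatoSolutionOn`, `IsRegularPoint`, `rotZ`), and proves the elementary implication between
its two printed-shape forms:

* `SFL3` — **(SFL³)**: a local Leray solution `(U, P) ∈ 𝒩(u₀)` (`IsLocalLeraySolution 1 u₀ U P`,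
  Kang–Miura–Tsai Def. 3.2 = Jia–Šverák 2013 Def. 1) whose datum `u₀ ∈ L³` is weakly divergence
  free, and such that `u₀` and `U` are (a.e., resp. a.e. in space–time `{t > 0}`) axisymmetric
  and swirl-free about a common vertical axis `b + ℝ e_z`, is regular (essentially bounded near)
  at every point of `(0, ∞) × ℝ³`.  The symmetry hypotheses are written in the «about» form of
  `…Theorems.L3TimeExponentPincerConvergingAxes` / `…SpaceTimeAxisymmetry` / `…SpaceTimeSwirlFree`
  (`U t (b + R_θ (x - b)) = R_θ (U t x)`, `(x - b)₀ U₁ - (x - b)₁ U₀ = 0`), which is exactly what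
  the compactness step delivers for the limit.
* `SFL3Mild` — **(SFL³-mild)** (memo Addendum A §A.1): for such a datum the Kato solution
  (mild, `C([0,T); L³)`) is GLOBAL — there is one `u` with `IsKatoSolutionOn T 1 u₀ u` for every
  `T > 0`.
* `sfl3_of_sfl3Mild` — **(SFL³-mild) ⇒ (SFL³)** (kernel, unconditional): by weak–strong uniqueness
  for local Leray solutions with `L³` data (**W**, `leray_solution_ae_eq_kato_holds`: Jia–Šverák
  2013 Lemma 3 / Lemarié-Rieusset 2016 Thm. 15.1 (B)) every `U ∈ 𝒩(u₀)` agrees a.e. on each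
  `(0, T) × ℝ³` with the global Kato solution, which obeys Kato's bound `|u| ≤ C/√t` a.e. on
  `(0, S) × ℝ³` (**R**, `kato_solution_le_div_sqrt_holds`); hence `U` is essentially bounded on the
  centred cylinder `Q*_{√t/2}(t, x) ⊆ (3t/4, 5t/4) × ℝ³` — a regular point.  (No symmetry is used:
  the symmetry hypotheses of `SFL3` only restrict the data to which `SFL3Mild` is applied.)

Status and nearest print (memo §2b, Addendum A, nsreg-lit PRECISION 2026-08-27): neither node is
in print.  Swirl-free axisymmetric GLOBAL regularity is classical for `H²`/`H¹` data
(Ladyzhenskaya 1968, Ukhovskii–Yudovich 1968; Lemarié-Rieusset 2016 Thm. 10.4 — tree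
`axisymmetric_no_swirl_global_regularity_holds`), for `H^{1/2}` data (Abidi 2008) and for
`ω_θ(0)/r`-type vorticity data of infinite energy (Gallay–Šverák 2015); the `L³`-datum /
local-Leray version is the memo's «first statement one can actually attack» (plan: η-maximum
principle started at a positive time + Jia–Šverák 2013 Lemma 7).  Consumers: the (J) reduction
`…Theorems.L3TimeExponentPincerCritModulusNoSwirlReduction.critSmoothingNoSwirlB_of_sfl3`.

WHAT THIS IS NOT: not NS regularity or blow-up; `SFL3`, `SFL3Mild` are OPEN obligation nodes
(neither asserted nor refuted here), living entirely in the swirl-free class (hard cores 15453 /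
1964 concern data WITH swirl); the crux `L3CascadeJaw` is untouched; no crux claim.
-/

noncomputable section

open MeasureTheory Set Function Filter Topology TopologicalSpace Metric
open scoped ENNReal NNReal

namespace Summit.NavierStokesRegularity.NavierStokesRegularity.Theorems.L3TimeExponentPincerSFL3

open Literature.Analysis.FluidPDE

/-- **(SFL³): swirl-free axisymmetric local Leray solutions with `L³` data are regular for
`t > 0`.**  For every point `b` (the axis is the vertical line `b + ℝ e_z`), every weakly
divergence-free `u₀ ∈ L³(ℝ³; ℝ³)` and every local Leray solution `(U, P) ∈ 𝒩(u₀)` of the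
unit-viscosity equations (`IsLocalLeraySolution 1 u₀ U P`): if `u₀` is a.e. axisymmetric about
that axis (`u₀ (b + R_θ (x - b)) = R_θ (u₀ x)` for every `θ` and a.e. `x`) and a.e. swirl-free
about it (`(x - b)₀ (u₀ x)₁ - (x - b)₁ (u₀ x)₀ = 0` a.e.), and `U` has the same two symmetries for
a.e. `(t, x)` with `t > 0`, then every point `z = (t, x)` with `t > 0` is a regular point of `U`
(`IsRegularPoint`: `U` essentially bounded on some centred parabolic cylinder `Q*_r(z)`).  The
symmetry of the datum follows from that of the solution (`U(t) → u₀` in `L²_loc`); both are kept,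
in the form the compactness step (J) delivers them, so that the node is usable without that
lemma.  Planner nsreg-p2 ROUND-12 §2b, statement (L); not in print (module docstring). -/
@[conjecture] def SFL3 : Prop :=
  ∀ (b : EuclideanSpace ℝ (Fin 3)) (u₀ : EuclideanSpace ℝ (Fin 3) → EuclideanSpace ℝ (Fin 3))
    (U : ℝ → EuclideanSpace ℝ (Fin 3) → EuclideanSpace ℝ (Fin 3))
    (P : ℝ → EuclideanSpace ℝ (Fin 3) → ℝ),
    MemLp u₀ 3 volume → IsWeaklyDivFree u₀ → IsLocalLeraySolution 1 u₀ U P →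
    (∀ θ : ℝ, ∀ᵐ x ∂volume, u₀ (b + rotZ θ (x - b)) = rotZ θ (u₀ x)) →
    (∀ᵐ x ∂volume, (x - b) 0 * u₀ x 1 - (x - b) 1 * u₀ x 0 = 0) →
    (∀ θ : ℝ, ∀ᵐ z : ℝ × EuclideanSpace ℝ (Fin 3) ∂volume, 0 < z.1 →
      U z.1 (b + rotZ θ (z.2 - b)) = rotZ θ (U z.1 z.2)) →
    (∀ᵐ z : ℝ × EuclideanSpace ℝ (Fin 3) ∂volume, 0 < z.1 →
      (z.2 - b) 0 * U z.1 z.2 1 - (z.2 - b) 1 * U z.1 z.2 0 = 0) →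
    ∀ z : ℝ × EuclideanSpace ℝ (Fin 3), 0 < z.1 → IsRegularPoint U z

/-- **(SFL³-mild): the Kato solution from a swirl-free axisymmetric `L³` datum is global.**  For
every point `b` and every weakly divergence-free `u₀ ∈ L³(ℝ³; ℝ³)` which is a.e. axisymmetric and
a.e. swirl-free about the vertical axis through `b`, there is ONE field `u` which
is a Kato solution on `[0, T)` from `u₀` (`IsKatoSolutionOn T 1 u₀ u`: mild in duality form,
`C([0,T); L³)`, `u 0 = u₀`, measurable) for EVERY `T > 0` — i.e. `T_max(u₀) = ∞`.  Planner
nsreg-p2 ROUND-12 Addendum A §A.1 (with a proof plan: Kato smoothing, the `η = ω_θ/r` maximum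
principle from a positive time, Jia–Šverák 2013 Lemma 7); not in print (module docstring). -/
@[conjecture] def SFL3Mild : Prop :=
  ∀ (b : EuclideanSpace ℝ (Fin 3)) (u₀ : EuclideanSpace ℝ (Fin 3) → EuclideanSpace ℝ (Fin 3)),
    MemLp u₀ 3 volume → IsWeaklyDivFree u₀ →
    (∀ θ : ℝ, ∀ᵐ x ∂volume, u₀ (b + rotZ θ (x - b)) = rotZ θ (u₀ x)) →
    (∀ᵐ x ∂volume, (x - b) 0 * u₀ x 1 - (x - b) 1 * u₀ x 0 = 0) →
    ∃ u : ℝ → EuclideanSpace ℝ (Fin 3) → EuclideanSpace ℝ (Fin 3),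
      ∀ T : ℝ, 0 < T → IsKatoSolutionOn T 1 u₀ u

/-- The centred cylinder `Q*_{√t/2}(t, x)` lies in the strip `(0, 2t + 1) × ℝ³` and above the
time `3t/4`. -/
theorem parabolicCylinderCentered_subset {t : ℝ} (ht : 0 < t) (x : EuclideanSpace ℝ (Fin 3)) :
    parabolicCylinderCentered (Real.sqrt t / 2) ((t, x) : ℝ × EuclideanSpace ℝ (Fin 3)) ⊆
      (Ioo (3 * t / 4) (2 * t + 1)) ×ˢ (univ : Set (EuclideanSpace ℝ (Fin 3))) := by
  intro w hw
  rw [mem_parabolicCylinderCentered] at hw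
  have hr : (Real.sqrt t / 2) ^ 2 = t / 4 := by
    rw [div_pow, Real.sq_sqrt ht.le]; norm_num
  rw [hr] at hw
  refine ⟨⟨?_, ?_⟩, mem_univ _⟩
  · have := hw.1.1; simp only at this; linarith
  · have := hw.1.2; simp only at this; linarith

/-- **(SFL³-mild) ⇒ (SFL³)** (kernel): weak–strong uniqueness for local Leray solutions with `L³`
data (`leray_solution_ae_eq_kato_holds`) identifies every `U ∈ 𝒩(u₀)` a.e. on each strip with
the global Kato solution, which is a.e. bounded by `C/√t` on `(0, S) × ℝ³`
(`kato_solution_le_div_sqrt_holds`); so `U` is essentially bounded on `Q*_{√t/2}(t, x)`. -/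
theorem sfl3_of_sfl3Mild (h : SFL3Mild) : SFL3 := by
  intro b u₀ U P hu₀ hdiv hU hax hsw _ _ z hz
  obtain ⟨u, hu⟩ := h b u₀ hu₀ hdiv hax hsw
  obtain ⟨t, x⟩ := z
  simp only at hz
  -- identification with the Kato solution on `(0, 2t + 2) × ℝ³`
  have hT : 0 < 2 * t + 2 := by linarith
  have hW := leray_solution_ae_eq_kato_holds u₀ hu₀ hdiv U P hU (2 * t + 2) u (hu _ hT)
  -- Kato's bound on `(0, 2t + 1) × ℝ³`
  obtain ⟨C, hC⟩ := kato_solution_le_div_sqrt_holds 1 (2 * t + 2) u₀ u one_pos (hu _ hT)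
    (2 * t + 1) (by linarith) (by linarith)
  refine ⟨Real.sqrt t / 2, by positivity, ?_⟩
  set Q : Set (ℝ × EuclideanSpace ℝ (Fin 3)) :=
    parabolicCylinderCentered (Real.sqrt t / 2) ((t, x) : ℝ × EuclideanSpace ℝ (Fin 3)) with hQ
  have hsub := parabolicCylinderCentered_subset hz x
  have hsub1 : Q ⊆ Ioo (0 : ℝ) (2 * t + 1) ×ˢ (univ : Set (EuclideanSpace ℝ (Fin 3))) :=
    hsub.trans (prod_mono (Ioo_subset_Ioo (by positivity) le_rfl) Subset.rfl)
  have hsub2 : Q ⊆ Ioo (0 : ℝ) (2 * t + 2) ×ˢ (univ : Set (EuclideanSpace ℝ (Fin 3))) :=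
    hsub.trans (prod_mono (Ioo_subset_Ioo (by positivity) (by linarith)) Subset.rfl)
  have h1 : ∀ᵐ w ∂(volume.restrict Q), uncurry U w = uncurry u w :=
    ae_restrict_of_ae_restrict_of_subset hsub2 hW
  have h2 : ∀ᵐ w ∂(volume.restrict Q), ‖u w.1 w.2‖ ≤ C / Real.sqrt w.1 :=
    ae_restrict_of_ae_restrict_of_subset hsub1 hC
  have h3 : ∀ᵐ w ∂(volume.restrict Q), w ∈ Q :=
    ae_restrict_mem (isOpen_parabolicCylinderCentered _ _).measurableSet
  -- the bound `|C| / √(3t/4)` on the cylinder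
  have hlow : 0 < Real.sqrt (3 * t / 4) := Real.sqrt_pos.2 (by positivity)
  have hbd : ∀ᵐ w ∂(volume.restrict Q), ‖uncurry U w‖ ≤ |C| / Real.sqrt (3 * t / 4) := by
    filter_upwards [h1, h2, h3] with w hw1 hw2 hw3
    have hw : 3 * t / 4 < w.1 := (hsub hw3).1.1
    have hws : Real.sqrt (3 * t / 4) ≤ Real.sqrt w.1 := Real.sqrt_le_sqrt hw.le
    have hws0 : 0 < Real.sqrt w.1 := hlow.trans_le hws
    rw [hw1]
    calc ‖uncurry u w‖ = ‖u w.1 w.2‖ := rfl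
      _ ≤ C / Real.sqrt w.1 := hw2
      _ ≤ |C| / Real.sqrt w.1 := by gcongr; exact le_abs_self C
      _ ≤ |C| / Real.sqrt (3 * t / 4) := by gcongr
  rw [eLpNorm_exponent_top]
  exact eLpNormEssSup_lt_top_of_ae_bound hbd

/-- **(SFL³-mild) at the origin axis suffices for data symmetric about the `x₂`-axis** —
sanity form connecting to the tree's pointwise predicates: a weakly divergence-free `u₀ ∈ L³`
with `IsAxisymmetric u₀` and `HasNoSwirl u₀` satisfies the a.e. «about `b = 0`» hypotheses of
`SFL3Mild`. -/
theorem sfl3Mild_apply_of_isAxisymmetric (h : SFL3Mild)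
    {u₀ : EuclideanSpace ℝ (Fin 3) → EuclideanSpace ℝ (Fin 3)} (hu₀ : MemLp u₀ 3 volume)
    (hdiv : IsWeaklyDivFree u₀) (hax : IsAxisymmetric u₀) (hsw : HasNoSwirl u₀) :
    ∃ u : ℝ → EuclideanSpace ℝ (Fin 3) → EuclideanSpace ℝ (Fin 3),
      ∀ T : ℝ, 0 < T → IsKatoSolutionOn T 1 u₀ u := by
  refine h 0 u₀ hu₀ hdiv (fun θ => Eventually.of_forall fun x => ?_)
    (Eventually.of_forall fun x => ?_)
  · simpa using hax θ x
  · have := hsw x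
    rw [swirl] at this
    simpa using this

end Summit.NavierStokesRegularity.NavierStokesRegularity.Theorems.L3TimeExponentPincerSFL3

end
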